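import Mathlib
import Summits.ValiantsHypothesis.ValiantsHypothesis.Theses.RigidityForcesSymmetry
import Summits.ValiantsHypothesis.ValiantsHypothesis.Theorems.HubHub
import Literature.Computability.AlgebraicComplexity.VPDeterminantalQPProofs
import Literature.Computability.AlgebraicComplexity.ValiantClasses
import Literature.Computability.AlgebraicComplexity.ValiantConjectureProofs
import Literature.Computability.AlgebraicComplexity.RazElusiveGeneralProofs

/-!
# `GrenetBoundToVH` (item `stmt-ValiantsHypothesis-4167`): Grenet's bound infinitely often
# implies Valiant's hypothesis

Support item of the route `ValiantsHypothesis/RigidityForcesSymmetry`: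

  `GrenetLowerBound → ValiantsHypothesis`, where
  `GrenetLowerBound := ∀ n₀, ∃ n ≥ n₀, 2 ^ n - 1 ≤ dc(per_n)` (over `ℂ`).

Proof — bookkeeping over DISCHARGED named facts, as in `Theorems/BorderApolarityGctBridge.lean`:

1. `eventually_two_pow_qpExp_lt`: for every template constant `c` the quasi-polynomial bound
   `2 ^ ((log₂ n + c) ^ c)` is EVENTUALLY below Grenet's function `2 ^ n - 1` (polylog versus
   linear: `(log₂ n + c) ^ c ≤ 2 ^ c (log₂ n) ^ c < 2 ^ (log₂ n) / 2 ≤ n / 2`, via the tree's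
   growth lemma `Literature.Computability.AlgebraicComplexity.eventually_mul_pow_lt_two_pow`
   (`RazElusiveGeneralProofs.lean`, from Mathlib's `tendsto_pow_const_div_const_pow_of_one_lt`).
   The hypothesis is only an infinitely-often lower bound, so the eventual form of the
   arithmetic is what is needed (an i.o. gap point would not suffice).
2. `GrenetBoundToVH_proof`: if `per` were a `VP` family then `n ↦ dc(per_n)` would be
   quasi-polynomially bounded (`isQPBounded_determinantalComplexity_of_isVPFamily_holds`;
   Bürgisser–Clausen–Shokrollahi 1997, Cor. (21.40)) with some constant `c`; step 1 gives `N`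
   beyond which the template is `< 2 ^ n - 1`, and `GrenetLowerBound` at `N` gives `n ≥ N` with
   `2 ^ n - 1 ≤ dc(per_n) ≤ 2 ^ ((log₂ n + c) ^ c) < 2 ^ n - 1`, absurd. Hence
   `¬ IsVPFamily (per_n)_n`, and the hub lemma
   `Summit.ValiantsHypothesis.Hub.valiantsHypothesis_of_not_isVPFamily_per` fed with the renaming
   bridge `mem_VP_ofFintype_iff_holds` and Valiant's theorem `perFamily_mem_VNP_holds ℂ`
   (`per ∈ VNP`) gives `VP ℂ ≠ VNP ℂ`.
-/

namespace Summit.ValiantsHypothesis.ValiantsHypothesis.Theorems.RigidityForcesSymmetryGrenetBoundToVH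

open Literature.Computability.AlgebraicComplexity

/-- **Polylog versus linear, eventual form.** For every template constant `c` there is `N` with
`2 ^ ((log₂ n + c) ^ c) < 2 ^ n - 1` for all `n ≥ N`: writing `L = log₂ n` (`2 ^ L ≤ n`), for
`L ≥ c` one has `(L + c) ^ c ≤ 2 ^ c · L ^ c`, and `2 · 2 ^ c · L ^ c < 2 ^ L ≤ n` for large `L`
(`eventually_mul_pow_lt_two_pow`), so `(log₂ n + c) ^ c ≤ n - 1` and
`2 ^ (n - 1) < 2 ^ n - 1` (`n ≥ 2`). [folklore] -/
theorem eventually_two_pow_qpExp_lt (c : ℕ) :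
    ∃ N : ℕ, ∀ n ≥ N, 2 ^ ((Nat.log 2 n + c) ^ c) < 2 ^ n - 1 := by
  obtain ⟨T, hT⟩ := eventually_mul_pow_lt_two_pow c (2 ^ c * 2)
  refine ⟨2 ^ max T (max c 1), fun n hn => ?_⟩
  set L := Nat.log 2 n with hL
  have hn0 : n ≠ 0 := by have := Nat.two_pow_pos (max T (max c 1)); omega
  have hTL : max T (max c 1) ≤ L := Nat.le_log_of_pow_le (by norm_num) hn
  have hT' : T ≤ L := le_trans (le_max_left _ _) hTL
  have hcL : c ≤ L := le_trans (le_trans (le_max_left _ _) (le_max_right _ _)) hTL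
  have h1L : 1 ≤ L := le_trans (le_trans (le_max_right _ _) (le_max_right _ _)) hTL
  -- `(L + c)^c ≤ (2L)^c = 2^c L^c`
  have h1 : (L + c) ^ c ≤ 2 ^ c * L ^ c := by
    rw [← mul_pow]; exact Nat.pow_le_pow_left (by omega) c
  -- `2 · 2^c · L^c < 2^L ≤ n`
  have h2 : 2 ^ c * 2 * L ^ c < 2 ^ L := hT L hT'
  have hlog : 2 ^ L ≤ n := Nat.pow_log_le_self 2 hn0
  have h3 : 2 * (L + c) ^ c < n := by
    calc 2 * (L + c) ^ c ≤ 2 * (2 ^ c * L ^ c) := Nat.mul_le_mul_left 2 h1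
      _ = 2 ^ c * 2 * L ^ c := by ring
      _ < 2 ^ L := h2
      _ ≤ n := hlog
  have h4 : 1 ≤ (L + c) ^ c := Nat.one_le_pow _ _ (by omega)
  have h5 : (L + c) ^ c ≤ n - 1 := by omega
  have h6 : 2 ^ ((L + c) ^ c) ≤ 2 ^ (n - 1) := Nat.pow_le_pow_right (by norm_num) h5
  have h7 : 2 ^ n = 2 * 2 ^ (n - 1) := by rw [← pow_succ']; congr 1; omega
  have h8 : 2 ≤ 2 ^ (n - 1) :=
    calc 2 = 2 ^ 1 := rfl
      _ ≤ 2 ^ (n - 1) := Nat.pow_le_pow_right (by norm_num) (by omega)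
  omega

/-- **Settles `stmt-ValiantsHypothesis-4167`** (`RigidityForcesSymmetry.GrenetBoundToVH`, stated
verbatim): Grenet's lower bound `2 ^ n - 1 ≤ dc(per_n)` infinitely often implies Valiant's
hypothesis `VP ℂ ≠ VNP ℂ`. If the permanent family were in `VP`, `n ↦ dc(per_n)` would be
quasi-polynomially bounded (`isQPBounded_determinantalComplexity_of_isVPFamily_holds`,
Bürgisser–Clausen–Shokrollahi 1997 Cor. (21.40)), contradicting the hypothesis beyond the point
where the template drops below `2 ^ n - 1` (`eventually_two_pow_qpExp_lt`); the hub lemma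
`Hub.valiantsHypothesis_of_not_isVPFamily_per` with the renaming bridge
`mem_VP_ofFintype_iff_holds` and `perFamily_mem_VNP_holds ℂ` (Valiant 1979) concludes.
[folklore] -/
theorem GrenetBoundToVH_proof :
    Summit.ValiantsHypothesis.ValiantsHypothesis.Theses.RigidityForcesSymmetry.GrenetBoundToVH := by
  unfold Summit.ValiantsHypothesis.ValiantsHypothesis.Theses.RigidityForcesSymmetry.GrenetBoundToVH
  intro hG
  refine Summit.ValiantsHypothesis.Hub.valiantsHypothesis_of_not_isVPFamily_per ?_
    (mem_VP_ofFintype_iff_holds _) (perFamily_mem_VNP_holds ℂ)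
  intro hVP
  obtain ⟨c, hc⟩ := isQPBounded_determinantalComplexity_of_isVPFamily_holds _ hVP
  obtain ⟨N, hN⟩ := eventually_two_pow_qpExp_lt c
  obtain ⟨n, hn, hle⟩ := hG N
  exact absurd (hN n hn) (not_lt.mpr (hle.trans (hc n)))

end Summit.ValiantsHypothesis.ValiantsHypothesis.Theorems.RigidityForcesSymmetryGrenetBoundToVH
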